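import Mathlib
import Summits.NavierStokesRegularity.NavierStokesRegularity.Theses.ParabolicDriftLiouville
import HarnessLib

/-!
# `ParabolicDriftLiouville.DiagonalContainment` — the passive parabolic-drift Liouville theorem
  contains the Type-I ancient Liouville statement on the diagonal `b := u`
  (route `ParabolicDriftLiouville`, item stmt-NavierStokesRegularity-19504, support)

**Statement.** `ParabolicDriftLiouville → TypeIAncientLiouville`.

PROOF. Let `u` be in the KNSS-gauge Type-I class (smooth on `t < 0`, divergence free, Oseen-mild,
`‖u(t,x)‖ ≤ C/√(−t)`) and fix `t₀ < 0`; put `δ = −t₀/2 > 0` and shift time, `ũ(t) = u(t − δ)`. Then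
`ũ` is smooth and divergence free on `t < 0`, Oseen-mild with drift `ũ` (the Oseen identity is
autonomous: translate the time integral), and `‖ũ(t,x)‖ ≤ C/√(δ − t)`: this is the parabolic class
with `T = δ`, `A = C`, `b = ũ`. The hypothesis kills `ũ` on `t < 0`, i.e. `u ≡ 0` on `t < −δ`, in
particular at `t₀ = −2δ`. (No backward-end argument is needed: the shift is by an arbitrary `δ > 0`.)

HONEST FRAMING: a conditional implication between two OPEN Liouville statements; nothing here bears
on the regularity problem itself.
-/

noncomputable section

set_option linter.dupNamespace false

namespace Summit.NavierStokesRegularity.NavierStokesRegularity.Theorems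

open MeasureTheory Set Filter Topology Function
open Literature.Analysis Literature.Analysis.FluidPDE

/-- **Item stmt-NavierStokesRegularity-19504** (`ParabolicDriftLiouville.DiagonalContainment`): the
parabolic-drift Liouville statement implies the Type-I ancient Liouville statement (diagonal
`b := u` after a time shift by `δ > 0`). [this file] -/
theorem parabolicDriftLiouville_diagonalContainment_proof :
    Summit.NavierStokesRegularity.NavierStokesRegularity.Theses.ParabolicDriftLiouville.DiagonalContainment := by
  unfold Summit.NavierStokesRegularity.NavierStokesRegularity.Theses.ParabolicDriftLiouville.DiagonalContainment
    Summit.NavierStokesRegularity.NavierStokesRegularity.Theses.ParabolicDriftLiouville.ParabolicDriftLiouville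
    Summit.NavierStokesRegularity.NavierStokesRegularity.Theses.ParabolicDriftLiouville.TypeIAncientLiouville
  intro hPDL C u hu t₀ ht₀ x₀
  obtain ⟨hsmooth, hdiv, hmild, hdecay⟩ := hu
  -- the shift `δ = −t₀/2`
  set δ : ℝ := -t₀ / 2 with hδ
  have hδpos : 0 < δ := by rw [hδ]; linarith
  set w : ℝ → EuclideanSpace ℝ (Fin 3) → EuclideanSpace ℝ (Fin 3) := fun t => u (t - δ) with hw
  -- smoothness of the shifted field on `t < 0`
  have hφ : ContDiff ℝ (⊤ : ℕ∞) fun p : ℝ × EuclideanSpace ℝ (Fin 3) => (p.1 - δ, p.2) :=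
    (contDiff_fst.sub contDiff_const).prodMk contDiff_snd
  have hmaps : MapsTo (fun p : ℝ × EuclideanSpace ℝ (Fin 3) => (p.1 - δ, p.2))
      (Iio 0 ×ˢ univ) (Iio 0 ×ˢ univ) := by
    intro p hp
    refine ⟨?_, mem_univ _⟩
    have h1 : p.1 < 0 := hp.1
    show p.1 - δ < 0
    linarith
  have hwsmooth : ContDiffOn ℝ (⊤ : ℕ∞) (uncurry w) (Iio 0 ×ˢ univ) := by
    have h := hsmooth.comp hφ.contDiffOn hmaps
    exact h.congr fun p _ => rfl
  -- divergence free and the parabolic bound with `T = δ`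
  have hwdiv : ∀ t < 0, VectorCalculus.IsDivFree (w t) := fun t ht => hdiv (t - δ) (by linarith)
  have hwbd : ∀ t < 0, ∀ x, ‖w t x‖ ≤ C / Real.sqrt (δ - t) := by
    intro t ht x
    have h := hdecay (t - δ) (by linarith) x
    have e : -(t - δ) = δ - t := by ring
    rw [e] at h
    exact h
  -- the Oseen identity is autonomous
  have hwmild : ∀ s t : ℝ, s < t → t < 0 → ∀ x, w t x =
      heatFlow (w s) (t - s) x - ∫ τ in Ioo s t, ∫ y,
        oseenKernel (t - τ) (x - y) (w τ y) (w τ y) := by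
    intro s t hst ht x
    have h := hmild (s - δ) (t - δ) (by linarith) (by linarith) x
    have e1 : t - δ - (s - δ) = t - s := by ring
    rw [e1] at h
    have e2 : (∫ τ in Ioo (s - δ) (t - δ), ∫ y,
        oseenKernel (t - δ - τ) (x - y) (u τ y) (u τ y)) =
        ∫ τ in Ioo s t, ∫ y, oseenKernel (t - τ) (x - y) (w τ y) (w τ y) := by
      have hle : s - δ ≤ t - δ := by linarith
      rw [← integral_Ioc_eq_integral_Ioo, ← intervalIntegral.integral_of_le hle,
        ← integral_Ioc_eq_integral_Ioo, ← intervalIntegral.integral_of_le hst.le]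
      have hR : (∫ τ in s..t, ∫ y, oseenKernel (t - τ) (x - y) (w τ y) (w τ y)) =
          ∫ τ in s..t, (fun σ => ∫ y, oseenKernel (t - δ - σ) (x - y) (u σ y) (u σ y)) (τ - δ) :=
        intervalIntegral.integral_congr fun τ _ => by
          simp only [hw]
          rw [show t - δ - (τ - δ) = t - τ by ring]
      rw [hR, intervalIntegral.integral_comp_sub_right
        (fun σ => ∫ y, oseenKernel (t - δ - σ) (x - y) (u σ y) (u σ y)) δ]
    rw [e2] at h
    exact h
  -- the parabolic-drift Liouville theorem on the diagonal kills `w`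
  have hzero := hPDL C C δ w w hδpos hwsmooth hwdiv hwbd hwsmooth hwdiv hwmild hwbd
  have ht' : t₀ + δ < 0 := by rw [hδ]; linarith
  have h := hzero (t₀ + δ) ht' x₀
  simpa [hw] using h

end Summit.NavierStokesRegularity.NavierStokesRegularity.Theorems

end
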